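import Literature.NumberTheory.Sieve.SmoothSaddlePointPhi
import HarnessLib

/-!
# Uniform estimates for the saddle point `α(x, y)` and for `φ₂(α, y)` on the whole range `x ≥ y ≥ y₀`

Topic `Literature/NumberTheory/Sieve`; a PROVED tool file (no definition, no named fact) toward
`Literature.NumberTheory.Sieve.HTLocalBehaviour` (Hildebrand–Tenenbaum, *On integers free of large prime
factors*, Trans. AMS 296 (1986), Theorem 3: `Ψ(cx, y) = Ψ(x, y) c^{α(x,y)} (1 + O(1/u + log y/y))`
uniformly for `x ≥ y ≥ 2`, `1 ≤ c ≤ y`). The deduction of Theorem 3 from Theorem 1 (op. cit. §6) uses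
the orders of magnitude of `α = α(x, y)` and `φ₂(α, y)` UNIFORMLY in `x ≥ y ≥ 2` (op. cit. Lemma 2
(3.3)–(3.4) and Lemma 4 (3.8): `α ≫ ū/(u log y)`, `φ₂(α, y) ≍ (u log y)² / ū`, `u = log x/log y`,
`ū = min(u, y/log y)`). The tree (`SmoothSaddlePointPhi`, `SmoothSaddlePointApprox`) has these only for
`(log x)^3 ≤ y ≤ x`; here we prove the LOWER bounds that §6 needs on the whole range `x ≥ y ≥ y₀`, from
Chebyshev's bounds for `θ` alone:

* `le_saddlePhi₂_saddlePoint_uniform` — `φ₂(α(x,y), y) ≥ c log x · log y`;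
* `sq_log_div_le_saddlePhi₂_saddlePoint` — `φ₂(α(x,y), y) ≥ (log x)² log y/(6 y)` (Cauchy–Schwarz:
  `(-φ₁)² ≤ φ₂ · π(y)`);
* `exists_min_le_saddlePoint` — `α(x, y) ≥ (1/12) min(1/log y, y/(log y · log x))`;
* `exists_one_sub_saddlePoint_mul_log_le` — `(1 - α) log y ≤ 2 log(80 u₀)` when `log x ≤ u₀ log y`;
* `saddlePhi₂_le_exp_mul_saddlePhi₂` — the two-point comparison `φ₂(σ', y) ≤ e^{(σ-σ')(log y + 2/σ')} φ₂(σ, y)`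
  for `0 < σ' ≤ σ` (no lower bound on `σ'`, unlike `saddlePhi₂_le_rpow_mul`);
* `log_smoothZeta_sub_le` — the second-order UPPER bound at a saddle point `a` of `e^{L'}`:
  `(b L' + log ζ(b, y)) - (a L' + log ζ(a, y)) ≤ φ₂(a, y)(b - a)²/2` for `0 < a ≤ b`
  (companion of the gain `log_smoothZeta_sub_ge` of `SmoothCountLocal`);
* Chebyshev in blocks `(t/e², t]`: `exists_blocks` (`θ(t) - θ(t/e²) ≥ t/10`, and
  `Σ_{z^{1-ε} < p ≤ z} 1/p ≥ ε/40`, `Σ_{z^{1-ε} < p ≤ z} log p/p ≥ ε log z/40` for `ε log z ≥ 4`,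
  `z^{1-ε} ≥ t₀`) — the only prime-number input, also used by `SmoothCountDickmanLower`.

## The regimes (proof of `le_saddlePhi₂_saddlePoint_uniform`)

For `y ≥ (log x)^3` this is the tree's `le_saddlePhi₂_saddlePoint`. For `y < (log x)^3` one has
`α ≤ 3/4` (`-φ₁(3/4, y) ≤ 6 y^{1/4} + 30 < y^{1/3} < log x`), and then either `α log y ≤ 1`, where
termwise `p^α - 1 ≍ α log p` gives `-φ₁(α) ≤ π(y)/α` and `φ₂(α) ≥ π(y)/(9α²) ≥ log x/(9α) ≥ log x log y/9`,
or `1/log y < α ≤ 3/4`, where `-φ₁(α, y) ≤ 30 y^{1-α}` (partial summation, the primes with `p^α < 5/4`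
being `O(y^{1/4})` in number) against `φ₂(α, y) ≥ Σ_{√y < p ≤ y} log² p · p^{-α} ≥ (log y/8) y^{1-α}`.

## References

* [HildebrandTenenbaum1986] A. Hildebrand, G. Tenenbaum, Trans. AMS 296 (1986) 265–290, §3 Lemmas 2–4,
  §6 (held: `paper:doi-10-1090-s0002-9947-1986-0837811-1`, pp. 272–274, 282–284).
-/

noncomputable section

open Real Filter Finset MeasureTheory Chebyshev

namespace Literature.NumberTheory.Sieve

variable {σ : ℝ} {y : ℕ}

/-! ### Chebyshev in blocks `(t/e², t]` -/

/-- `θ(B) - θ(A) = Σ_{A < p ≤ B} log p` for `0 ≤ A ≤ B`. [folklore] -/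
theorem theta_sub_theta_eq_sum_filter {A B : ℝ} (hA : 0 ≤ A) (hAB : A ≤ B) :
    θ B - θ A = ∑ p ∈ ((Nat.primesLE ⌊(B : ℝ)⌋₊).filter (fun p : ℕ => (A : ℝ) < (p : ℝ))), Real.log p := by
  rw [theta_eq_sum_primesLE, theta_eq_sum_primesLE]
  have hfilt : (Nat.primesLE ⌊B⌋₊).filter (fun p : ℕ => ¬ (A < (p : ℝ))) = Nat.primesLE ⌊A⌋₊ := by
    ext p
    simp only [Finset.mem_filter, Nat.mem_primesLE, not_lt]
    constructor
    · rintro ⟨⟨-, hp⟩, hpA⟩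
      exact ⟨Nat.le_floor hpA, hp⟩
    · rintro ⟨hpA, hp⟩
      have hpA' : (p : ℝ) ≤ A := le_trans (by exact_mod_cast hpA) (Nat.floor_le hA)
      exact ⟨⟨hpA.trans (Nat.floor_mono hAB), hp⟩, hpA'⟩
  rw [← Finset.sum_filter_add_sum_filter_not (Nat.primesLE ⌊B⌋₊) (fun p : ℕ => A < (p : ℝ)), hfilt]
  ring

/-- `e² ≥ 7.38`. [folklore] -/
theorem exp_two_ge : (7.38 : ℝ) ≤ Real.exp 2 := by
  have h1 := Real.exp_one_gt_d9
  have h2 : Real.exp 2 = Real.exp 1 * Real.exp 1 := by rw [← Real.exp_add]; norm_num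
  rw [h2]; nlinarith

/-- **Chebyshev in a block**: there is `t₀ ≥ 2` with `θ(t) - θ(t/e²) ≥ t/10` for `t ≥ t₀`
(`θ(t) ≥ (log 2/2) t - c₁`, `θ(t/e²) ≤ log 4 · t/e²`, and `log 2 (1/2 - 2/e²) > 0.15`). [folklore] -/
theorem exists_theta_sub_theta_div_ge :
    ∃ t₀ : ℝ, 2 ≤ t₀ ∧ ∀ t : ℝ, t₀ ≤ t → t / 10 ≤ θ t - θ (t / Real.exp 2) := by
  obtain ⟨c₁, hc₁, hθ⟩ := exists_theta_ge_linear
  refine ⟨max 2 (20 * c₁), le_max_left _ _, fun t ht => ?_⟩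
  have ht2 : 2 ≤ t := le_trans (le_max_left _ _) ht
  have htc : 20 * c₁ ≤ t := le_trans (le_max_right _ _) ht
  have ht0 : 0 ≤ t := by linarith
  have he := exp_two_ge
  have he0 : 0 < Real.exp 2 := Real.exp_pos 2
  have h1 : θ (t / Real.exp 2) ≤ Real.log 4 * (t / Real.exp 2) := theta_le_linear (by positivity)
  have h2 := hθ t ht0
  have hl4 : Real.log 4 = 2 * Real.log 2 := by
    rw [show (4 : ℝ) = 2 ^ 2 by norm_num, Real.log_pow]; push_cast; ring
  have hl2 := Real.log_two_gt_d9
  have hl2' := Real.log_two_lt_d9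
  have h3 : t / Real.exp 2 ≤ t / 7.38 := div_le_div_of_nonneg_left ht0 (by norm_num) he
  have h4 : Real.log 4 * (t / Real.exp 2) ≤ 2 * Real.log 2 * (t / 7.38) := by
    rw [hl4]; exact mul_le_mul_of_nonneg_left h3 (by linarith)
  have h5 : 2 * Real.log 2 * (t / 7.38) ≤ 0.188 * t := by
    rw [show 2 * Real.log 2 * (t / 7.38) = 2 * Real.log 2 / 7.38 * t by ring]
    refine mul_le_mul_of_nonneg_right ?_ ht0
    rw [div_le_iff₀ (by norm_num)]; linarith
  have h6 : 0.3465 * t ≤ Real.log 2 / 2 * t := by nlinarith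
  linarith

/-- **The block package.** There is `t₀ ≥ 2` such that: (i) `θ(t) - θ(t/e²) ≥ t/10` for `t ≥ t₀`;
(ii) `Σ_{z^{1-ε} < p ≤ z} 1/p ≥ ε/40` and (iii) `Σ_{z^{1-ε} < p ≤ z} log p/p ≥ ε log z/40` whenever
`z > 1`, `0 < ε ≤ 1`, `ε log z ≥ 4` and `z^{1-ε} ≥ t₀` (sum the blocks `(z e^{-2(j+1)}, z e^{-2j}]`,
`j < ⌊ε log z/2⌋`, each contributing `≥ 1/(10 log z)`, resp. `≥ 1/10`). [folklore] -/
theorem exists_blocks :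
    ∃ t₀ : ℝ, 2 ≤ t₀ ∧ (∀ t : ℝ, t₀ ≤ t → t / 10 ≤ θ t - θ (t / Real.exp 2)) ∧
      (∀ (ε z : ℝ), 1 < z → 0 < ε → ε ≤ 1 → 4 ≤ ε * Real.log z → t₀ ≤ z ^ (1 - ε) →
        ε / 40 ≤ ∑ p ∈ ((Nat.primesLE ⌊(z : ℝ)⌋₊).filter (fun p : ℕ => (z ^ (1 - ε) : ℝ) < (p : ℝ))), (1 : ℝ) / p) ∧
      (∀ (ε z : ℝ), 1 < z → 0 < ε → ε ≤ 1 → 4 ≤ ε * Real.log z → t₀ ≤ z ^ (1 - ε) →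
        ε * Real.log z / 40 ≤ ∑ p ∈ ((Nat.primesLE ⌊(z : ℝ)⌋₊).filter (fun p : ℕ => (z ^ (1 - ε) : ℝ) < (p : ℝ))), Real.log p / p) := by
  obtain ⟨t₀, ht₀2, hθ⟩ := exists_theta_sub_theta_div_ge
  -- one block `(t/e², t]`
  have hblock_log : ∀ t : ℝ, t₀ ≤ t → 1 / 10 ≤ ∑ p ∈ ((Nat.primesLE ⌊(t : ℝ)⌋₊).filter (fun p : ℕ => (t / Real.exp 2 : ℝ) < (p : ℝ))), Real.log p / p := by
    intro t ht
    have ht0 : 0 < t := by linarith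
    have he1 : 1 ≤ Real.exp 2 := Real.one_le_exp (by norm_num)
    have hsum := theta_sub_theta_eq_sum_filter (A := t / Real.exp 2) (B := t) (by positivity)
      (div_le_self ht0.le he1)
    calc (1 : ℝ) / 10 ≤ (θ t - θ (t / Real.exp 2)) / t := by
          rw [le_div_iff₀ ht0]; linarith [hθ t ht]
      _ = ∑ p ∈ ((Nat.primesLE ⌊(t : ℝ)⌋₊).filter (fun p : ℕ => (t / Real.exp 2 : ℝ) < (p : ℝ))), Real.log p / t := by rw [hsum, Finset.sum_div]
      _ ≤ ∑ p ∈ ((Nat.primesLE ⌊(t : ℝ)⌋₊).filter (fun p : ℕ => (t / Real.exp 2 : ℝ) < (p : ℝ))), Real.log p / p := by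
          refine Finset.sum_le_sum fun p hp => ?_
          rw [Finset.mem_filter, Nat.mem_primesLE] at hp
          have hp2 : (2 : ℝ) ≤ p := by exact_mod_cast hp.1.2.two_le
          have hpt : (p : ℝ) ≤ t := le_trans (by exact_mod_cast hp.1.1) (Nat.floor_le ht0.le)
          exact div_le_div_of_nonneg_left (Real.log_nonneg (by linarith)) (by linarith) hpt
  have hblock_inv : ∀ t : ℝ, t₀ ≤ t →
      1 / (10 * Real.log t) ≤ ∑ p ∈ ((Nat.primesLE ⌊(t : ℝ)⌋₊).filter (fun p : ℕ => (t / Real.exp 2 : ℝ) < (p : ℝ))), (1 : ℝ) / p := by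
    intro t ht
    have ht1 : 1 < t := by linarith
    have hlt : 0 < Real.log t := Real.log_pos ht1
    have h1 := hblock_log t ht
    have h2 : ∑ p ∈ ((Nat.primesLE ⌊(t : ℝ)⌋₊).filter (fun p : ℕ => (t / Real.exp 2 : ℝ) < (p : ℝ))), Real.log p / p ≤
        Real.log t * ∑ p ∈ ((Nat.primesLE ⌊(t : ℝ)⌋₊).filter (fun p : ℕ => (t / Real.exp 2 : ℝ) < (p : ℝ))), (1 : ℝ) / p := by
      rw [Finset.mul_sum]
      refine Finset.sum_le_sum fun p hp => ?_
      rw [Finset.mem_filter, Nat.mem_primesLE] at hp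
      have hp2 : (2 : ℝ) ≤ p := by exact_mod_cast hp.1.2.two_le
      have hp0 : (0 : ℝ) < p := by linarith
      have hpt : (p : ℝ) ≤ t := le_trans (by exact_mod_cast hp.1.1) (Nat.floor_le (by linarith))
      have hlog : Real.log p ≤ Real.log t := Real.log_le_log hp0 hpt
      rw [mul_one_div]
      exact div_le_div_of_nonneg_right hlog hp0.le
    rw [div_le_iff₀ (by positivity)]
    calc (1 : ℝ) = 1 / 10 * 10 := by norm_num
      _ ≤ (∑ p ∈ ((Nat.primesLE ⌊(t : ℝ)⌋₊).filter (fun p : ℕ => (t / Real.exp 2 : ℝ) < (p : ℝ))), Real.log p / p) * 10 := by gcongr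
      _ ≤ (Real.log t * ∑ p ∈ ((Nat.primesLE ⌊(t : ℝ)⌋₊).filter (fun p : ℕ => (t / Real.exp 2 : ℝ) < (p : ℝ))), (1 : ℝ) / p) * 10 := by gcongr
      _ = (∑ p ∈ ((Nat.primesLE ⌊(t : ℝ)⌋₊).filter (fun p : ℕ => (t / Real.exp 2 : ℝ) < (p : ℝ))), (1 : ℝ) / p) * (10 * Real.log t) := by ring
  -- `J` blocks, by induction, for a nonnegative weight `w` with a per-block bound `b`
  have hblocks : ∀ (w : ℕ → ℝ) (b : ℝ → ℝ), (∀ p, 0 ≤ w p) →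
      (∀ t z : ℝ, t₀ ≤ t → t ≤ z → b z ≤ ∑ p ∈ ((Nat.primesLE ⌊(t : ℝ)⌋₊).filter (fun p : ℕ => (t / Real.exp 2 : ℝ) < (p : ℝ))), w p) →
      ∀ (J : ℕ) (z : ℝ), t₀ ≤ z * Real.exp (-(2 * (J : ℝ))) →
        (J : ℝ) * b z ≤ ∑ p ∈ ((Nat.primesLE ⌊(z : ℝ)⌋₊).filter (fun p : ℕ => (z * Real.exp (-(2 * (J : ℝ))) : ℝ) < (p : ℝ))), w p := by
    intro w b hw hb J
    induction J with
    | zero =>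
        intro z _
        simp only [CharP.cast_eq_zero, zero_mul]
        exact Finset.sum_nonneg fun p _ => hw p
    | succ J ih =>
        intro z hz
        set t : ℝ := z * Real.exp (-(2 * (J : ℝ))) with htdef
        have hexp : z * Real.exp (-(2 * ((J + 1 : ℕ) : ℝ))) = t / Real.exp 2 := by
          rw [htdef, eq_div_iff (Real.exp_pos 2).ne', mul_assoc, ← Real.exp_add]
          push_cast; ring_nf
        rw [hexp] at hz ⊢
        have he1 : 1 ≤ Real.exp 2 := Real.one_le_exp (by norm_num)
        have ht₀t : t₀ ≤ t := by
          have h0 : 0 < t := by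
            have := lt_of_lt_of_le (by linarith : (0 : ℝ) < t₀) hz
            have h2 : t = t / Real.exp 2 * Real.exp 2 := by field_simp
            rw [h2]; positivity
          exact le_trans hz (div_le_self h0.le he1)
        have ht0 : 0 < t := by linarith
        have htz : t ≤ z := by
          rw [htdef]
          have hz0 : 0 < z := by
            by_contra hcon; push Not at hcon
            have : t ≤ 0 := by rw [htdef]; exact mul_nonpos_of_nonpos_of_nonneg hcon (Real.exp_pos _).le
            linarith
          have : Real.exp (-(2 * (J : ℝ))) ≤ 1 :=
            Real.exp_le_one_iff.mpr (neg_nonpos.mpr (by positivity))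
          exact mul_le_of_le_one_right hz0.le this
        have hIH := ih z ht₀t
        have hB := hb t z ht₀t htz
        -- the two finsets `((Nat.primesLE ⌊(z : ℝ)⌋₊).filter (fun p : ℕ => (t : ℝ) < (p : ℝ)))` and `((Nat.primesLE ⌊(t : ℝ)⌋₊).filter (fun p : ℕ => (t/e² : ℝ) < (p : ℝ)))` are disjoint and contained in `((Nat.primesLE ⌊(z : ℝ)⌋₊).filter (fun p : ℕ => (t/e² : ℝ) < (p : ℝ)))`
        have hsub : ((Nat.primesLE ⌊(z : ℝ)⌋₊).filter (fun p : ℕ => (t : ℝ) < (p : ℝ))) ∪ ((Nat.primesLE ⌊(t : ℝ)⌋₊).filter (fun p : ℕ => (t / Real.exp 2 : ℝ) < (p : ℝ))) ⊆ ((Nat.primesLE ⌊(z : ℝ)⌋₊).filter (fun p : ℕ => (t / Real.exp 2 : ℝ) < (p : ℝ))) := by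
          intro p hp
          rw [Finset.mem_union] at hp
          simp only [Finset.mem_filter, Nat.mem_primesLE] at hp ⊢
          rcases hp with ⟨⟨hpz, hpp⟩, htp⟩ | ⟨⟨hpt, hpp⟩, htp⟩
          · exact ⟨⟨hpz, hpp⟩, lt_of_le_of_lt (div_le_self ht0.le he1) htp⟩
          · exact ⟨⟨hpt.trans (Nat.floor_mono htz), hpp⟩, htp⟩
        have hdisj : Disjoint (((Nat.primesLE ⌊(z : ℝ)⌋₊).filter (fun p : ℕ => (t : ℝ) < (p : ℝ)))) (((Nat.primesLE ⌊(t : ℝ)⌋₊).filter (fun p : ℕ => (t / Real.exp 2 : ℝ) < (p : ℝ)))) := by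
          rw [Finset.disjoint_left]
          intro p hp1 hp2
          simp only [Finset.mem_filter, Nat.mem_primesLE] at hp1 hp2
          have h1 : (p : ℝ) ≤ t := le_trans (by exact_mod_cast hp2.1.1) (Nat.floor_le ht0.le)
          linarith [hp1.2]
        calc (((J + 1 : ℕ) : ℝ)) * b z = (J : ℝ) * b z + b z := by push_cast; ring
          _ ≤ ∑ p ∈ ((Nat.primesLE ⌊(z : ℝ)⌋₊).filter (fun p : ℕ => (t : ℝ) < (p : ℝ))), w p + ∑ p ∈ ((Nat.primesLE ⌊(t : ℝ)⌋₊).filter (fun p : ℕ => (t / Real.exp 2 : ℝ) < (p : ℝ))), w p := add_le_add hIH hB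
          _ = ∑ p ∈ ((Nat.primesLE ⌊(z : ℝ)⌋₊).filter (fun p : ℕ => (t : ℝ) < (p : ℝ))) ∪ ((Nat.primesLE ⌊(t : ℝ)⌋₊).filter (fun p : ℕ => (t / Real.exp 2 : ℝ) < (p : ℝ))), w p := (Finset.sum_union hdisj).symm
          _ ≤ ∑ p ∈ ((Nat.primesLE ⌊(z : ℝ)⌋₊).filter (fun p : ℕ => (t / Real.exp 2 : ℝ) < (p : ℝ))), w p :=
              Finset.sum_le_sum_of_subset_of_nonneg hsub fun p _ _ => hw p
  -- from `J = ⌊ε log z/2⌋` blocks to the interval `(z^{1-ε}, z]`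
  have hmain : ∀ (w : ℕ → ℝ) (b : ℝ → ℝ), (∀ p, 0 ≤ w p) → (∀ z, 1 < z → 0 ≤ b z) →
      (∀ t z : ℝ, t₀ ≤ t → t ≤ z → b z ≤ ∑ p ∈ ((Nat.primesLE ⌊(t : ℝ)⌋₊).filter (fun p : ℕ => (t / Real.exp 2 : ℝ) < (p : ℝ))), w p) →
      ∀ (ε z : ℝ), 1 < z → 0 < ε → ε ≤ 1 → 4 ≤ ε * Real.log z → t₀ ≤ z ^ (1 - ε) →
        ε * Real.log z / 4 * b z ≤ ∑ p ∈ ((Nat.primesLE ⌊(z : ℝ)⌋₊).filter (fun p : ℕ => (z ^ (1 - ε) : ℝ) < (p : ℝ))), w p := by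
    intro w b hw hb0 hb ε z hz1 hε hε1 hεz hz
    have hz0 : 0 < z := by linarith
    have hlogz : 0 < Real.log z := Real.log_pos hz1
    set J : ℕ := ⌊ε * Real.log z / 2⌋₊ with hJ
    have hJle : (J : ℝ) ≤ ε * Real.log z / 2 := Nat.floor_le (by positivity)
    have hJge : ε * Real.log z / 4 ≤ J := by
      have := Nat.lt_floor_add_one (ε * Real.log z / 2)
      rw [← hJ] at this
      linarith
    -- `z e^{-2J} ≥ z^{1-ε} ≥ t₀`
    have hcmp : z ^ (1 - ε) ≤ z * Real.exp (-(2 * (J : ℝ))) := by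
      rw [Real.rpow_def_of_pos hz0]
      conv_rhs => rw [← Real.exp_log hz0, ← Real.exp_add]
      rw [Real.exp_le_exp]
      nlinarith
    have hJz : t₀ ≤ z * Real.exp (-(2 * (J : ℝ))) := le_trans hz hcmp
    have h1 := hblocks w b hw hb J z hJz
    have hsub : ((Nat.primesLE ⌊(z : ℝ)⌋₊).filter (fun p : ℕ => (z * Real.exp (-(2 * (J : ℝ))) : ℝ) < (p : ℝ))) ⊆ ((Nat.primesLE ⌊(z : ℝ)⌋₊).filter (fun p : ℕ => (z ^ (1 - ε) : ℝ) < (p : ℝ))) := by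
      intro p hp
      simp only [Finset.mem_filter] at hp ⊢
      exact ⟨hp.1, lt_of_le_of_lt hcmp hp.2⟩
    calc ε * Real.log z / 4 * b z ≤ (J : ℝ) * b z :=
          mul_le_mul_of_nonneg_right hJge (hb0 z hz1)
      _ ≤ ∑ p ∈ ((Nat.primesLE ⌊(z : ℝ)⌋₊).filter (fun p : ℕ => (z * Real.exp (-(2 * (J : ℝ))) : ℝ) < (p : ℝ))), w p := h1
      _ ≤ ∑ p ∈ ((Nat.primesLE ⌊(z : ℝ)⌋₊).filter (fun p : ℕ => (z ^ (1 - ε) : ℝ) < (p : ℝ))), w p :=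
          Finset.sum_le_sum_of_subset_of_nonneg hsub fun p _ _ => hw p
  refine ⟨t₀, ht₀2, hθ, ?_, ?_⟩
  · intro ε z hz1 hε hε1 hεz hz
    have h := hmain (fun p : ℕ => (1 : ℝ) / p) (fun z => 1 / (10 * Real.log z))
      (fun p => by positivity) (fun z hz => by
        have := Real.log_pos hz; positivity) ?_ ε z hz1 hε hε1 hεz hz
    · have hlogz : 0 < Real.log z := Real.log_pos hz1
      calc ε / 40 = ε * Real.log z / 4 * (1 / (10 * Real.log z)) := by field_simp; ring
        _ ≤ _ := h
    · intro t z' ht htz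
      have ht1 : 1 < t := by linarith
      have hlt : 0 < Real.log t := Real.log_pos ht1
      have hlz : Real.log t ≤ Real.log z' := Real.log_le_log (by linarith) htz
      calc 1 / (10 * Real.log z') ≤ 1 / (10 * Real.log t) := by
            apply one_div_le_one_div_of_le (by positivity); linarith
        _ ≤ _ := hblock_inv t ht
  · intro ε z hz1 hε hε1 hεz hz
    have h := hmain (fun p : ℕ => Real.log p / p) (fun _ => 1 / 10)
      (fun p => div_nonneg (Real.log_natCast_nonneg p) (Nat.cast_nonneg p)) (fun z _ => by norm_num)
      (fun t z' ht _ => hblock_log t ht) ε z hz1 hε hε1 hεz hz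
    calc ε * Real.log z / 40 = ε * Real.log z / 4 * (1 / 10) := by ring
      _ ≤ _ := h

/-! ### Chebyshev's bounds for `π(y)` and for the primes in `(√y, y]` -/

/-- **`π(N) ≤ 6 N/log N`** (`N ≥ 2`), from Mathlib's `Chebyshev.pi_le_log4_mul_div`
(`π(x) ≤ log 4 · x/log √x + √x`) and `√N ≤ 2N/log N`. [folklore] -/
theorem card_primesLE_le_six_mul_div_log {N : ℕ} (hN : 2 ≤ N) :
    (#(Nat.primesLE N) : ℝ) ≤ 6 * ((N : ℝ) / Real.log N) := by
  rw [Nat.primesLE_card_eq_primeCounting]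
  have hN1 : (1 : ℝ) < N := by exact_mod_cast hN
  have hN0 : (0 : ℝ) < N := by linarith
  have hlog : 0 < Real.log N := Real.log_pos hN1
  have h := Chebyshev.pi_le_log4_mul_div hN1
  rw [Nat.floor_natCast, Real.log_sqrt hN0.le] at h
  have hl4 : Real.log 4 ≤ 1.3863 := log_four_le
  have hs0 : 0 < Real.sqrt N := Real.sqrt_pos.mpr hN0
  have hlogle : Real.log N ≤ 2 * Real.sqrt N := by
    have h1 := Real.log_le_sub_one_of_pos hs0
    rw [Real.log_sqrt hN0.le] at h1; linarith
  have hsq : Real.sqrt N * Real.sqrt N = N := Real.mul_self_sqrt hN0.le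
  have hsqrtle : Real.sqrt N ≤ 2 * ((N : ℝ) / Real.log N) := by
    rw [mul_div_assoc', le_div_iff₀ hlog]
    nlinarith
  have hdiv : 0 < (N : ℝ) / Real.log N := div_pos hN0 hlog
  have heq : Real.log 4 * N / (Real.log N / 2) = 2 * Real.log 4 * ((N : ℝ) / Real.log N) := by
    field_simp
  calc (Nat.primeCounting N : ℝ) ≤ Real.log 4 * N / (Real.log N / 2) + Real.sqrt N := h
    _ = 2 * Real.log 4 * ((N : ℝ) / Real.log N) + Real.sqrt N := by rw [heq]
    _ ≤ 2 * 1.3863 * ((N : ℝ) / Real.log N) + 2 * ((N : ℝ) / Real.log N) :=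
        add_le_add (mul_le_mul_of_nonneg_right (by linarith) hdiv.le) hsqrtle
    _ ≤ 6 * ((N : ℝ) / Real.log N) := by nlinarith

/-- **`π(y) ≥ y/(4 log y)`** beyond a threshold (`θ(y) ≤ π(y) log y`, `θ(y) ≥ (log 2/2) y - c₁`).
[folklore] -/
theorem exists_card_primesLE_ge :
    ∃ y₀ : ℕ, 2 ≤ y₀ ∧ ∀ y : ℕ, y₀ ≤ y → (y : ℝ) / (4 * Real.log y) ≤ #(Nat.primesLE y) := by
  obtain ⟨c₁, hc₁, hθ⟩ := exists_theta_ge_linear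
  refine ⟨max 2 ⌈11 * c₁⌉₊, le_max_left _ _, fun y hy => ?_⟩
  have hy2 : 2 ≤ y := le_trans (le_max_left _ _) hy
  have hyc : 11 * c₁ ≤ y :=
    le_trans (Nat.le_ceil _) (by exact_mod_cast le_trans (le_max_right _ _) hy)
  have hy1 : (1 : ℝ) < y := by exact_mod_cast lt_of_lt_of_le one_lt_two hy2
  have hy0 : (0 : ℝ) ≤ y := by linarith
  have hlog : 0 < Real.log y := Real.log_pos hy1
  have h1 : θ y ≤ (Nat.primeCounting y : ℝ) * Real.log y := theta_le_pi_mul_log y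
  rw [← Nat.primesLE_card_eq_primeCounting] at h1
  have h2 := hθ y hy0
  have hl2 := Real.log_two_gt_d9
  have h3 : 0.3465 * (y : ℝ) ≤ Real.log 2 / 2 * y := by nlinarith
  rw [div_le_iff₀ (by positivity)]
  nlinarith

/-- **`θ(t) - θ(√t) ≥ t/4`** beyond a threshold (`θ(√t) ≤ log 4 · √t ≤ log 4 · t/30` for `t ≥ 900`).
[folklore] -/
theorem exists_theta_sub_theta_sqrt_ge :
    ∃ t₁ : ℝ, 2 ≤ t₁ ∧ ∀ t : ℝ, t₁ ≤ t → t / 4 ≤ θ t - θ (Real.sqrt t) := by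
  obtain ⟨c₁, hc₁, hθ⟩ := exists_theta_ge_linear
  refine ⟨max 900 (20 * c₁), le_trans (by norm_num) (le_max_left _ _), fun t ht => ?_⟩
  have ht900 : 900 ≤ t := le_trans (le_max_left _ _) ht
  have htc : 20 * c₁ ≤ t := le_trans (le_max_right _ _) ht
  have ht0 : 0 < t := by linarith
  have hs30 : 30 ≤ Real.sqrt t := by
    rw [show (30 : ℝ) = Real.sqrt (30 ^ 2) by rw [Real.sqrt_sq (by norm_num)]]
    exact Real.sqrt_le_sqrt (by nlinarith)
  have hss : Real.sqrt t * Real.sqrt t = t := Real.mul_self_sqrt ht0.le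
  have hs : Real.sqrt t ≤ t / 30 := by
    rw [le_div_iff₀ (by norm_num)]; nlinarith
  have h1 : θ (Real.sqrt t) ≤ Real.log 4 * Real.sqrt t := theta_le_linear (Real.sqrt_nonneg _)
  have h2 := hθ t ht0.le
  have hl4 : Real.log 4 ≤ 1.3863 := log_four_le
  have hl40 : 0 ≤ Real.log 4 := Real.log_nonneg (by norm_num)
  have hl2 := Real.log_two_gt_d9
  have h3 : 0.3465 * t ≤ Real.log 2 / 2 * t := by nlinarith
  have h4 : Real.log 4 * Real.sqrt t ≤ 1.3863 * (t / 30) :=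
    mul_le_mul hl4 hs (Real.sqrt_nonneg _) (by norm_num)
  linarith

/-! ### The regime `σ log y ≤ 1`: `p^σ - 1 ≍ σ log p` termwise -/

/-- `e^t - 1 ≤ 3t` for `0 ≤ t ≤ 1` (`e^t - 1 = e^t (1 - e^{-t}) ≤ e · t`). [folklore] -/
theorem exp_sub_one_le_three_mul {t : ℝ} (ht0 : 0 ≤ t) (ht1 : t ≤ 1) :
    Real.exp t - 1 ≤ 3 * t := by
  have h1 : 1 - Real.exp (-t) ≤ t := by have := Real.add_one_le_exp (-t); linarith
  have h2 : Real.exp t ≤ 3 :=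
    le_trans (Real.exp_le_exp.2 ht1) (by have := Real.exp_one_lt_d9; linarith)
  have h3 : Real.exp t - 1 = Real.exp t * (1 - Real.exp (-t)) := by
    rw [mul_sub, mul_one, ← Real.exp_add, add_neg_cancel, Real.exp_zero]
  have h4 : 0 ≤ 1 - Real.exp (-t) := by
    have : Real.exp (-t) ≤ 1 := Real.exp_le_one_iff.mpr (by linarith)
    linarith
  rw [h3]
  calc Real.exp t * (1 - Real.exp (-t)) ≤ 3 * t := mul_le_mul h2 h1 h4 (by norm_num)

/-- For a prime `p ≤ y` and `σ > 0` with `σ log y ≤ 1`: `σ log p ≤ p^σ - 1 ≤ 3 σ log p`.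
[cite: HildebrandTenenbaum1986, Lemma 2 (3.3), proof] -/
theorem rpow_sub_one_bounds {p : ℕ} (hp : p ∈ Nat.primesLE y) (hσ : 0 < σ)
    (hσy : σ * Real.log y ≤ 1) :
    σ * Real.log p ≤ (p : ℝ) ^ σ - 1 ∧ (p : ℝ) ^ σ - 1 ≤ 3 * (σ * Real.log p) := by
  obtain ⟨hpy, hpp⟩ := Nat.mem_primesLE.1 hp
  have hp2 : (2 : ℝ) ≤ p := by exact_mod_cast hpp.two_le
  have hp0 : (0 : ℝ) < p := by linarith
  have hlogp : 0 ≤ Real.log p := Real.log_nonneg (by linarith)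
  have hlogpy : Real.log p ≤ Real.log y := Real.log_le_log hp0 (by exact_mod_cast hpy)
  have ht1 : σ * Real.log p ≤ 1 := le_trans (mul_le_mul_of_nonneg_left hlogpy hσ.le) hσy
  have ht0 : 0 ≤ σ * Real.log p := mul_nonneg hσ.le hlogp
  rw [Real.rpow_def_of_pos hp0, mul_comm (Real.log p) σ]
  exact ⟨by have := Real.add_one_le_exp (σ * Real.log p); linarith,
    exp_sub_one_le_three_mul ht0 ht1⟩

/-- Regime `σ log y ≤ 1`: **`-φ₁(σ, y) ≤ π(y)/σ`**. [cite: HildebrandTenenbaum1986, Lemma 2 (3.3), proof] -/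
theorem saddleSum_le_card_div (hσ : 0 < σ) (hσy : σ * Real.log y ≤ 1) :
    saddleSum σ y ≤ #(Nat.primesLE y) / σ := by
  rw [saddleSum_def, Finset.card_eq_sum_ones, Nat.cast_sum, Finset.sum_div]
  refine Finset.sum_le_sum fun p hp => ?_
  obtain ⟨h1, -⟩ := rpow_sub_one_bounds hp hσ hσy
  have hpp := Nat.prime_of_mem_primesLE hp
  have hlogp : 0 < Real.log p := Real.log_pos (by exact_mod_cast hpp.one_lt)
  have hD : 0 < (p : ℝ) ^ σ - 1 := lt_of_lt_of_le (mul_pos hσ hlogp) h1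
  push_cast
  rw [div_le_div_iff₀ hD hσ]
  linarith

/-- Regime `σ log y ≤ 1`: **`-φ₁(σ, y) ≥ π(y)/(3σ)`**. [cite: HildebrandTenenbaum1986, Lemma 2 (3.3), proof] -/
theorem card_div_le_saddleSum (hσ : 0 < σ) (hσy : σ * Real.log y ≤ 1) :
    #(Nat.primesLE y) / (3 * σ) ≤ saddleSum σ y := by
  rw [saddleSum_def, Finset.card_eq_sum_ones, Nat.cast_sum, Finset.sum_div]
  refine Finset.sum_le_sum fun p hp => ?_
  obtain ⟨h1, h2⟩ := rpow_sub_one_bounds hp hσ hσy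
  have hpp := Nat.prime_of_mem_primesLE hp
  have hlogp : 0 < Real.log p := Real.log_pos (by exact_mod_cast hpp.one_lt)
  have hD : 0 < (p : ℝ) ^ σ - 1 := lt_of_lt_of_le (mul_pos hσ hlogp) h1
  push_cast
  rw [div_le_div_iff₀ (by positivity) hD]
  linarith

/-- Regime `σ log y ≤ 1`: **`φ₂(σ, y) ≥ π(y)/(9σ²)`**. [cite: HildebrandTenenbaum1986, Lemma 4 (3.8), proof] -/
theorem card_div_le_saddlePhi₂ (hσ : 0 < σ) (hσy : σ * Real.log y ≤ 1) :
    #(Nat.primesLE y) / (9 * σ ^ 2) ≤ saddlePhi₂ σ y := by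
  rw [saddlePhi₂_def, Finset.card_eq_sum_ones, Nat.cast_sum, Finset.sum_div]
  refine Finset.sum_le_sum fun p hp => ?_
  obtain ⟨h1, h2⟩ := rpow_sub_one_bounds hp hσ hσy
  have hpp := Nat.prime_of_mem_primesLE hp
  have hp2 : (2 : ℝ) ≤ p := by exact_mod_cast hpp.two_le
  have hlogp : 0 < Real.log p := Real.log_pos (by exact_mod_cast hpp.one_lt)
  set D : ℝ := (p : ℝ) ^ σ - 1 with hDdef
  have hD : 0 < D := lt_of_lt_of_le (mul_pos hσ hlogp) h1
  have hP1 : 1 ≤ (p : ℝ) ^ σ := Real.one_le_rpow (by linarith) hσ.le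
  push_cast
  calc (1 : ℝ) / (9 * σ ^ 2) = Real.log p ^ 2 / (3 * (σ * Real.log p)) ^ 2 := by
        field_simp; norm_num
    _ ≤ Real.log p ^ 2 / D ^ 2 := by
        apply div_le_div_of_nonneg_left (sq_nonneg _) (pow_pos hD 2)
        exact pow_le_pow_left₀ hD.le h2 2
    _ = Real.log p ^ 2 * (1 / D ^ 2) := by ring
    _ ≤ Real.log p ^ 2 * ((p : ℝ) ^ σ / D ^ 2) := by
        apply mul_le_mul_of_nonneg_left _ (sq_nonneg _)
        exact div_le_div_of_nonneg_right hP1 (sq_nonneg _)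

/-! ### Cauchy–Schwarz: `(-φ₁)² ≤ φ₂ · π(y)` -/

/-- **Cauchy–Schwarz**: `(-φ₁(σ, y))² ≤ φ₂(σ, y) · π(y)` for `σ > 0`
(`(log p/(p^σ - 1))² = (log² p · p^σ/(p^σ - 1)²) · p^{-σ}` and `p^{-σ} ≤ 1`). [folklore] -/
theorem saddleSum_sq_le_saddlePhi₂_mul_card (hσ : 0 < σ) :
    saddleSum σ y ^ 2 ≤ saddlePhi₂ σ y * #(Nat.primesLE y) := by
  rw [saddleSum_def, saddlePhi₂_def, Finset.card_eq_sum_ones, Nat.cast_sum]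
  push_cast
  have hCS := Finset.sum_sq_le_sum_mul_sum_of_sq_le_mul (Nat.primesLE y)
    (r := fun p : ℕ => Real.log p / ((p : ℝ) ^ σ - 1))
    (f := fun p : ℕ => Real.log p ^ 2 * ((p : ℝ) ^ σ / ((p : ℝ) ^ σ - 1) ^ 2))
    (g := fun _ : ℕ => (1 : ℝ)) ?_ (fun _ _ => zero_le_one) ?_
  · exact hCS
  · intro p hp
    have hp2 : (2 : ℝ) ≤ p := by exact_mod_cast (Nat.prime_of_mem_primesLE hp).two_le
    have hP1 : 1 < (p : ℝ) ^ σ := Real.one_lt_rpow (by linarith) hσ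
    have : 0 ≤ (p : ℝ) ^ σ / ((p : ℝ) ^ σ - 1) ^ 2 := by positivity
    positivity
  · intro p hp
    have hp2 : (2 : ℝ) ≤ p := by exact_mod_cast (Nat.prime_of_mem_primesLE hp).two_le
    have hP1 : 1 < (p : ℝ) ^ σ := Real.one_lt_rpow (by linarith) hσ
    have hD : 0 < (p : ℝ) ^ σ - 1 := by linarith
    rw [mul_one, div_pow]
    calc Real.log p ^ 2 / ((p : ℝ) ^ σ - 1) ^ 2 = Real.log p ^ 2 * (1 / ((p : ℝ) ^ σ - 1) ^ 2) := by
          ring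
      _ ≤ Real.log p ^ 2 * ((p : ℝ) ^ σ / ((p : ℝ) ^ σ - 1) ^ 2) := by
          apply mul_le_mul_of_nonneg_left _ (sq_nonneg _)
          exact div_le_div_of_nonneg_right hP1.le (sq_nonneg _)

/-! ### `φ₂(σ, y) ≥ (log y/8) y^{1-σ}` from the primes in `(√y, y]` -/

/-- **`φ₂(σ, y) ≥ (log y/8) y^{1-σ}`** for `0 < σ ≤ 1` beyond a threshold in `y`
(`φ₂ ≥ Σ_{√y < p ≤ y} log² p · p^{-σ} ≥ (log y/2) y^{-σ} (θ(y) - θ(√y)) ≥ (log y/2) y^{-σ} · y/4`).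
[cite: HildebrandTenenbaum1986, Lemma 4 (3.8), proof] -/
theorem exists_log_mul_rpow_le_saddlePhi₂ :
    ∃ y₁ : ℕ, 2 ≤ y₁ ∧ ∀ (y : ℕ) (σ : ℝ), y₁ ≤ y → 0 < σ → σ ≤ 1 →
      Real.log y / 8 * (y : ℝ) ^ (1 - σ) ≤ saddlePhi₂ σ y := by
  obtain ⟨t₁, ht₁2, hθ⟩ := exists_theta_sub_theta_sqrt_ge
  refine ⟨⌈t₁⌉₊, ?_, fun y σ hy hσ _ => ?_⟩
  · have : (2 : ℝ) ≤ ⌈t₁⌉₊ := le_trans ht₁2 (Nat.le_ceil t₁)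
    exact_mod_cast this
  have hyt : t₁ ≤ y := le_trans (Nat.le_ceil t₁) (by exact_mod_cast hy)
  have hy2r : (2 : ℝ) ≤ y := by linarith
  have hy0 : (0 : ℝ) < y := by linarith
  have hy1 : (1 : ℝ) ≤ y := by linarith
  have hθy := hθ y hyt
  have hsy : Real.sqrt y ≤ y := Real.sqrt_le_iff.mpr ⟨hy0.le, by nlinarith⟩
  have hsum := theta_sub_theta_eq_sum_filter (A := Real.sqrt y) (B := (y : ℝ)) (Real.sqrt_nonneg _) hsy
  rw [Nat.floor_natCast] at hsum
  have h1 := sum_log_sq_mul_rpow_le_saddlePhi₂ hσ y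
  have hlogy : 0 ≤ Real.log y := Real.log_nonneg hy1
  -- restrict to `p > √y` and bound termwise
  have h2 : ∑ p ∈ ((Nat.primesLE ⌊((y : ℝ) : ℝ)⌋₊).filter (fun p : ℕ => (Real.sqrt y : ℝ) < (p : ℝ))), Real.log y / 2 * (y : ℝ) ^ (-σ) * Real.log p ≤
      ∑ p ∈ Nat.primesLE y, Real.log p ^ 2 * (p : ℝ) ^ (-σ) := by
    rw [Nat.floor_natCast]
    calc ∑ p ∈ (Nat.primesLE y).filter (fun p : ℕ => Real.sqrt y < (p : ℝ)),
          Real.log y / 2 * (y : ℝ) ^ (-σ) * Real.log p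
        ≤ ∑ p ∈ (Nat.primesLE y).filter (fun p : ℕ => Real.sqrt y < (p : ℝ)),
          Real.log p ^ 2 * (p : ℝ) ^ (-σ) := by
          refine Finset.sum_le_sum fun p hp => ?_
          rw [Finset.mem_filter, Nat.mem_primesLE] at hp
          obtain ⟨⟨hpy, hpp⟩, hps⟩ := hp
          have hp2 : (2 : ℝ) ≤ p := by exact_mod_cast hpp.two_le
          have hp0 : (0 : ℝ) < p := by linarith
          have hpy' : (p : ℝ) ≤ y := by exact_mod_cast hpy
          have hlogp0 : 0 ≤ Real.log p := Real.log_nonneg (by linarith)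
          -- `log p ≥ log y/2`
          have hlogp : Real.log y / 2 ≤ Real.log p := by
            have := Real.log_lt_log (Real.sqrt_pos.mpr hy0) hps
            rw [Real.log_sqrt hy0.le] at this
            linarith
          -- `p^{-σ} ≥ y^{-σ}`
          have hpow : (y : ℝ) ^ (-σ) ≤ (p : ℝ) ^ (-σ) :=
            Real.rpow_le_rpow_of_nonpos hp0 hpy' (by linarith)
          have hy0' : 0 ≤ (y : ℝ) ^ (-σ) := Real.rpow_nonneg hy0.le _
          calc Real.log y / 2 * (y : ℝ) ^ (-σ) * Real.log p
              ≤ Real.log p * (p : ℝ) ^ (-σ) * Real.log p := by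
                apply mul_le_mul_of_nonneg_right _ hlogp0
                exact mul_le_mul hlogp hpow hy0' hlogp0
            _ = Real.log p ^ 2 * (p : ℝ) ^ (-σ) := by ring
      _ ≤ ∑ p ∈ Nat.primesLE y, Real.log p ^ 2 * (p : ℝ) ^ (-σ) := by
          refine Finset.sum_le_sum_of_subset_of_nonneg (Finset.filter_subset _ _) fun p hp _ => ?_
          have hp2 : (2 : ℝ) ≤ p := by exact_mod_cast (Nat.prime_of_mem_primesLE hp).two_le
          have : 0 ≤ (p : ℝ) ^ (-σ) := Real.rpow_nonneg (by linarith) _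
          positivity
  have h3 : ∑ p ∈ ((Nat.primesLE ⌊((y : ℝ) : ℝ)⌋₊).filter (fun p : ℕ => (Real.sqrt y : ℝ) < (p : ℝ))), Real.log y / 2 * (y : ℝ) ^ (-σ) * Real.log p =
      Real.log y / 2 * (y : ℝ) ^ (-σ) * (θ y - θ (Real.sqrt y)) := by
    rw [hsum, Finset.mul_sum, Nat.floor_natCast]
  have h4 : (y : ℝ) ^ (1 - σ) = y * (y : ℝ) ^ (-σ) := by
    rw [sub_eq_add_neg, Real.rpow_add hy0, Real.rpow_one]
  have hy0' : 0 ≤ (y : ℝ) ^ (-σ) := Real.rpow_nonneg hy0.le _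
  calc Real.log y / 8 * (y : ℝ) ^ (1 - σ) = Real.log y / 2 * (y : ℝ) ^ (-σ) * (y / 4) := by
        rw [h4]; ring
    _ ≤ Real.log y / 2 * (y : ℝ) ^ (-σ) * (θ y - θ (Real.sqrt y)) :=
        mul_le_mul_of_nonneg_left hθy (by positivity)
    _ = ∑ p ∈ ((Nat.primesLE ⌊((y : ℝ) : ℝ)⌋₊).filter (fun p : ℕ => (Real.sqrt y : ℝ) < (p : ℝ))), Real.log y / 2 * (y : ℝ) ^ (-σ) * Real.log p := h3.symm
    _ ≤ ∑ p ∈ Nat.primesLE y, Real.log p ^ 2 * (p : ℝ) ^ (-σ) := h2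
    _ ≤ saddlePhi₂ σ y := h1

/-! ### `-φ₁(σ, y) ≤ 30 y^{1-σ}` for `1/log y < σ ≤ 3/4` -/

/-- **`-φ₁(σ, y) ≤ 30 y^{1-σ}`** for `1/log y < σ ≤ 3/4` beyond a threshold in `y`: the primes with
`p^σ ≥ 5/4` give `≤ 5 Σ log p · p^{-σ} ≤ 20 log 4 · y^{1-σ}` (partial summation), and the primes with
`p^σ < 5/4` (at most `(5/4)^{1/σ} + 1 ≤ y^{1/4} + 1` of them, each term `≤ 1/σ < log y`, present only
when `σ < 0.37`) give `≤ (y^{1/4} + 1) log y ≤ y^{3/5} ≤ y^{1-σ}`.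
[cite: HildebrandTenenbaum1986, Lemma 2 (3.3)–(3.4), proof] -/
theorem exists_saddleSum_le_mul_rpow :
    ∃ y₂ : ℕ, 2 ≤ y₂ ∧ ∀ (y : ℕ) (σ : ℝ), y₂ ≤ y → 1 / Real.log y < σ → σ ≤ 3 / 4 →
      saddleSum σ y ≤ 30 * (y : ℝ) ^ (1 - σ) := by
  obtain ⟨Y, hY1, hY⟩ := exists_log_le_mul_rpow (κ := 1 / 2) (ε := 7 / 20) (by norm_num) (by norm_num)
  refine ⟨max 3 ⌈Y⌉₊, le_trans (by norm_num) (le_max_left _ _), fun y σ hy hσℓ hσ34 => ?_⟩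
  have hy3 : 3 ≤ y := le_trans (le_max_left _ _) hy
  have hyY : Y ≤ y := le_trans (Nat.le_ceil Y) (by exact_mod_cast le_trans (le_max_right _ _) hy)
  have hy2 : 2 ≤ y := le_trans (by norm_num) hy3
  have hy1 : (1 : ℝ) < y := by exact_mod_cast lt_of_lt_of_le (by norm_num) hy3
  have hy0 : (0 : ℝ) < y := by linarith
  have hℓ : 0 < Real.log y := Real.log_pos hy1
  have hσ0 : 0 < σ := lt_trans (by positivity) hσℓ
  have hσ1 : σ < 1 := by linarith
  have h1σ : 1 / σ ≤ Real.log y := by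
    rw [div_le_iff₀ hσ0]
    have := (div_lt_iff₀ hℓ).1 hσℓ
    linarith
  set T : ℝ := ∑ p ∈ Nat.primesLE y, Real.log p * (p : ℝ) ^ (-σ) with hT
  -- partial summation: `T ≤ 4 log 4 · y^{1-σ}`
  have hpow0 : 0 ≤ (y : ℝ) ^ (1 - σ) := Real.rpow_nonneg hy0.le _
  have hTle : T ≤ 4 * Real.log 4 * (y : ℝ) ^ (1 - σ) := by
    have h1 := sum_primesLE_log_mul_rpow_le hσ0.le hy2
    have h2 := integral_rpow_neg_le_of_lt_one hσ1 hy2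
    have h3 : σ * ∫ t in (2 : ℝ)..y, t ^ (-σ) ≤ 3 * (y : ℝ) ^ (1 - σ) := by
      calc σ * ∫ t in (2 : ℝ)..y, t ^ (-σ) ≤ σ * ((y : ℝ) ^ (1 - σ) / (1 - σ)) :=
            mul_le_mul_of_nonneg_left h2 hσ0.le
        _ = σ / (1 - σ) * (y : ℝ) ^ (1 - σ) := by ring
        _ ≤ 3 * (y : ℝ) ^ (1 - σ) := by
            apply mul_le_mul_of_nonneg_right _ hpow0
            rw [div_le_iff₀ (by linarith)]; linarith
    have hl40 : 0 ≤ Real.log 4 := Real.log_nonneg (by norm_num)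
    calc T ≤ Real.log 4 * ((y : ℝ) ^ (1 - σ) + σ * ∫ t in (2 : ℝ)..y, t ^ (-σ)) := h1
      _ ≤ Real.log 4 * ((y : ℝ) ^ (1 - σ) + 3 * (y : ℝ) ^ (1 - σ)) := by gcongr
      _ = 4 * Real.log 4 * (y : ℝ) ^ (1 - σ) := by ring
  -- split the saddle sum at `p^σ ≥ 5/4`
  rw [saddleSum_def, ← Finset.sum_filter_add_sum_filter_not (Nat.primesLE y)
    (fun p : ℕ => (5 : ℝ) / 4 ≤ (p : ℝ) ^ σ)]
  -- the primes with `p^σ ≥ 5/4`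
  have hG : ∑ p ∈ (Nat.primesLE y).filter (fun p : ℕ => (5 : ℝ) / 4 ≤ (p : ℝ) ^ σ),
      Real.log p / ((p : ℝ) ^ σ - 1) ≤ 5 * T := by
    calc ∑ p ∈ (Nat.primesLE y).filter (fun p : ℕ => (5 : ℝ) / 4 ≤ (p : ℝ) ^ σ),
          Real.log p / ((p : ℝ) ^ σ - 1)
        ≤ ∑ p ∈ (Nat.primesLE y).filter (fun p : ℕ => (5 : ℝ) / 4 ≤ (p : ℝ) ^ σ),
          5 * (Real.log p * (p : ℝ) ^ (-σ)) := by
          refine Finset.sum_le_sum fun p hp => ?_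
          rw [Finset.mem_filter] at hp
          obtain ⟨hp, hP⟩ := hp
          have hp2 : (2 : ℝ) ≤ p := by exact_mod_cast (Nat.prime_of_mem_primesLE hp).two_le
          have hp0 : (0 : ℝ) < p := by linarith
          have hlogp : 0 ≤ Real.log p := Real.log_nonneg (by linarith)
          set P : ℝ := (p : ℝ) ^ σ with hPdef
          have hP0 : 0 < P := Real.rpow_pos_of_pos hp0 σ
          have hD : P / 5 ≤ P - 1 := by linarith
          rw [Real.rpow_neg hp0.le, ← hPdef]
          calc Real.log p / (P - 1) ≤ Real.log p / (P / 5) :=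
                div_le_div_of_nonneg_left hlogp (by positivity) hD
            _ = 5 * (Real.log p * P⁻¹) := by field_simp
      _ ≤ ∑ p ∈ Nat.primesLE y, 5 * (Real.log p * (p : ℝ) ^ (-σ)) := by
          refine Finset.sum_le_sum_of_subset_of_nonneg (Finset.filter_subset _ _) fun p hp _ => ?_
          have hp2 : (2 : ℝ) ≤ p := by exact_mod_cast (Nat.prime_of_mem_primesLE hp).two_le
          have : 0 ≤ (p : ℝ) ^ (-σ) := Real.rpow_nonneg (by linarith) _
          have : 0 ≤ Real.log p := Real.log_nonneg (by linarith)
          positivity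
      _ = 5 * T := by rw [hT, ← Finset.mul_sum]
  -- the primes with `p^σ < 5/4`
  have hB : ∑ p ∈ (Nat.primesLE y).filter (fun p : ℕ => ¬ ((5 : ℝ) / 4 ≤ (p : ℝ) ^ σ)),
      Real.log p / ((p : ℝ) ^ σ - 1) ≤ (y : ℝ) ^ (1 - σ) := by
    set B := (Nat.primesLE y).filter (fun p : ℕ => ¬ ((5 : ℝ) / 4 ≤ (p : ℝ) ^ σ)) with hBdef
    rcases B.eq_empty_or_nonempty with hBe | ⟨q, hq⟩
    · rw [hBe, Finset.sum_empty]; exact hpow0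
    -- from `q ∈ B`: `2^σ ≤ q^σ < 5/4`, so `σ log 2 < log (5/4) ≤ 1/4` and `σ < 0.37`
    have hσ37 : σ < 0.37 := by
      rw [hBdef, Finset.mem_filter, not_le] at hq
      obtain ⟨hq, hqσ⟩ := hq
      have hq2 : (2 : ℝ) ≤ q := by exact_mod_cast (Nat.prime_of_mem_primesLE hq).two_le
      have h2σ : (2 : ℝ) ^ σ < 5 / 4 :=
        lt_of_le_of_lt (Real.rpow_le_rpow (by norm_num) hq2 hσ0.le) hqσ
      have h3 : σ * Real.log 2 < Real.log (5 / 4) := by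
        have := Real.log_lt_log (Real.rpow_pos_of_pos two_pos σ) h2σ
        rwa [Real.log_rpow two_pos] at this
      have h4 : Real.log (5 / 4 : ℝ) ≤ 1 / 4 := by
        have := Real.log_le_sub_one_of_pos (by norm_num : (0 : ℝ) < 5 / 4); linarith
      have hl2 := Real.log_two_gt_d9
      nlinarith
    -- each term is `≤ 1/σ ≤ log y`
    have hterm : ∀ p ∈ B, Real.log p / ((p : ℝ) ^ σ - 1) ≤ Real.log y := by
      intro p hp
      rw [hBdef, Finset.mem_filter] at hp
      obtain ⟨hp, -⟩ := hp
      have hp2 : (2 : ℝ) ≤ p := by exact_mod_cast (Nat.prime_of_mem_primesLE hp).two_le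
      have hp0 : (0 : ℝ) < p := by linarith
      have hlogp : 0 < Real.log p := Real.log_pos (by linarith)
      have hD : σ * Real.log p ≤ (p : ℝ) ^ σ - 1 := by
        rw [Real.rpow_def_of_pos hp0]
        have := Real.add_one_le_exp (Real.log p * σ)
        nlinarith
      calc Real.log p / ((p : ℝ) ^ σ - 1) ≤ Real.log p / (σ * Real.log p) :=
            div_le_div_of_nonneg_left hlogp.le (mul_pos hσ0 hlogp) hD
        _ = 1 / σ := by field_simp
        _ ≤ Real.log y := h1σ
    -- `#B ≤ y^{1/4} + 1`
    have hcard : (#B : ℝ) ≤ (y : ℝ) ^ (1 / 4 : ℝ) + 1 := by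
      set N : ℝ := (5 / 4 : ℝ) ^ (1 / σ) with hN
      have hN0 : 0 ≤ N := Real.rpow_nonneg (by norm_num) _
      have hBsub : B ⊆ Finset.range (⌊N⌋₊ + 1) := by
        intro p hp
        rw [hBdef, Finset.mem_filter, not_le] at hp
        obtain ⟨-, hpσ⟩ := hp
        have hp0 : (0 : ℝ) ≤ p := Nat.cast_nonneg p
        rw [Finset.mem_range, Nat.lt_add_one_iff, Nat.le_floor_iff hN0]
        by_contra hcon
        push Not at hcon
        have : N ^ σ ≤ (p : ℝ) ^ σ := Real.rpow_le_rpow hN0 hcon.le hσ0.le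
        rw [hN, ← Real.rpow_mul (by norm_num), one_div_mul_cancel hσ0.ne', Real.rpow_one] at this
        linarith
      have h1 : #B ≤ ⌊N⌋₊ + 1 := le_trans (Finset.card_le_card hBsub) (by simp)
      have h2 : (#B : ℝ) ≤ N + 1 := by
        calc (#B : ℝ) ≤ ((⌊N⌋₊ + 1 : ℕ) : ℝ) := by exact_mod_cast h1
          _ = ⌊N⌋₊ + 1 := by push_cast; ring
          _ ≤ N + 1 := by linarith [Nat.floor_le hN0]
      have h3 : N ≤ (y : ℝ) ^ (1 / 4 : ℝ) := by
        calc N ≤ (5 / 4 : ℝ) ^ Real.log y := Real.rpow_le_rpow_of_exponent_le (by norm_num) h1σ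
          _ = Real.exp (Real.log (5 / 4) * Real.log y) := by
              rw [Real.rpow_def_of_pos (by norm_num)]
          _ ≤ Real.exp (Real.log y * (1 / 4)) := by
              rw [Real.exp_le_exp]
              have h4 : Real.log (5 / 4 : ℝ) ≤ 1 / 4 := by
                have := Real.log_le_sub_one_of_pos (by norm_num : (0 : ℝ) < 5 / 4); linarith
              nlinarith
          _ = (y : ℝ) ^ (1 / 4 : ℝ) := by rw [Real.rpow_def_of_pos hy0]
      linarith
    -- assemble: `Σ_B ≤ #B · log y ≤ (y^{1/4} + 1) log y ≤ y^{3/5} ≤ y^{1-σ}`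
    have hlogy_le : Real.log y ≤ 1 / 2 * (y : ℝ) ^ (7 / 20 : ℝ) := hY y hyY
    have hy14 : 1 ≤ (y : ℝ) ^ (1 / 4 : ℝ) := Real.one_le_rpow hy1.le (by norm_num)
    calc ∑ p ∈ B, Real.log p / ((p : ℝ) ^ σ - 1) ≤ ∑ p ∈ B, Real.log y := Finset.sum_le_sum hterm
      _ = #B * Real.log y := by rw [Finset.sum_const, nsmul_eq_mul]
      _ ≤ ((y : ℝ) ^ (1 / 4 : ℝ) + 1) * Real.log y := mul_le_mul_of_nonneg_right hcard hℓ.le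
      _ ≤ (2 * (y : ℝ) ^ (1 / 4 : ℝ)) * (1 / 2 * (y : ℝ) ^ (7 / 20 : ℝ)) :=
          mul_le_mul (by linarith) hlogy_le hℓ.le (by positivity)
      _ = (y : ℝ) ^ (3 / 5 : ℝ) := by
          rw [show (3 / 5 : ℝ) = 1 / 4 + 7 / 20 by norm_num, Real.rpow_add hy0]; ring
      _ ≤ (y : ℝ) ^ (1 - σ) := Real.rpow_le_rpow_of_exponent_le hy1.le (by linarith)
  -- total
  have hl4 : Real.log 4 ≤ 1.3863 := log_four_le
  calc _ ≤ 5 * T + (y : ℝ) ^ (1 - σ) := add_le_add hG hB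
    _ ≤ 5 * (4 * Real.log 4 * (y : ℝ) ^ (1 - σ)) + (y : ℝ) ^ (1 - σ) := by linarith [hTle]
    _ ≤ 30 * (y : ℝ) ^ (1 - σ) := by nlinarith

/-! ### `α(x, y) ≤ 3/4` as soon as `y < (log x)^3` -/

/-- **`α(x, y) ≤ 3/4` when `y < (log x)^3`** (`y ≥ 12¹²`, `x > 1`):
`-φ₁(3/4, y) ≤ Σ log p · p^{-3/4} + 30 ≤ 4 log 4 · y^{1/4} + 30 ≤ y^{1/3} < log x`. [folklore] -/
theorem saddlePoint_le_three_quarters {x : ℝ} (hy : 12 ^ 12 ≤ y) (hyL : (y : ℝ) < Real.log x ^ 3)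
    (hx : 1 < x) : saddlePoint x y ≤ 3 / 4 := by
  have hy2 : 2 ≤ y := le_trans (by norm_num) hy
  have hy' : (12 : ℝ) ^ 12 ≤ y := by exact_mod_cast hy
  have hy0 : (0 : ℝ) < y := lt_of_lt_of_le (by norm_num) hy'
  have hL0 : 0 < Real.log x := Real.log_pos hx
  apply saddlePoint_le_of_saddleSum_le hx hy2 (by norm_num : (0 : ℝ) < 3 / 4)
  have h1 := saddleSum_le_sum_primesLE_log_mul_rpow_add (by norm_num : (3 : ℝ) / 5 ≤ 3 / 4) hy2
  have h2 := sum_primesLE_log_mul_rpow_le (by norm_num : (0 : ℝ) ≤ 3 / 4) hy2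
  have h3 := integral_rpow_neg_le_of_lt_one (by norm_num : (3 : ℝ) / 4 < 1) hy2
  have h14 : (y : ℝ) ^ (1 - 3 / 4 : ℝ) = (y : ℝ) ^ (1 / 4 : ℝ) := by norm_num
  rw [h14] at h2 h3
  have hl40 : 0 ≤ Real.log 4 := Real.log_nonneg (by norm_num)
  have hl4 : Real.log 4 ≤ 1.3863 := log_four_le
  have hpow0 : 0 ≤ (y : ℝ) ^ (1 / 4 : ℝ) := Real.rpow_nonneg hy0.le _
  have hT : ∑ p ∈ Nat.primesLE y, Real.log p * (p : ℝ) ^ (-(3 / 4 : ℝ)) ≤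
      4 * Real.log 4 * (y : ℝ) ^ (1 / 4 : ℝ) := by
    calc ∑ p ∈ Nat.primesLE y, Real.log p * (p : ℝ) ^ (-(3 / 4 : ℝ))
        ≤ Real.log 4 * ((y : ℝ) ^ (1 / 4 : ℝ) + 3 / 4 * ∫ t in (2 : ℝ)..y, t ^ (-(3 / 4 : ℝ))) := h2
      _ ≤ Real.log 4 * ((y : ℝ) ^ (1 / 4 : ℝ) + 3 / 4 * ((y : ℝ) ^ (1 / 4 : ℝ) / (1 - 3 / 4))) := by
          gcongr
      _ = 4 * Real.log 4 * (y : ℝ) ^ (1 / 4 : ℝ) := by ring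
  -- `z = y^{1/12} ≥ 12`, `y^{1/4} = z³`, `y^{1/3} = z⁴`
  set z : ℝ := (y : ℝ) ^ (1 / 12 : ℝ) with hz
  have hz12 : 12 ≤ z := by
    have : (12 : ℝ) = ((12 : ℝ) ^ (12 : ℕ)) ^ (1 / 12 : ℝ) := by
      rw [← Real.rpow_natCast, ← Real.rpow_mul (by norm_num)]; norm_num
    rw [this, hz]
    exact Real.rpow_le_rpow (by norm_num) (by exact_mod_cast hy') (by norm_num)
  have hz3 : (y : ℝ) ^ (1 / 4 : ℝ) = z ^ (3 : ℕ) := by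
    rw [hz, ← Real.rpow_natCast, ← Real.rpow_mul hy0.le]; norm_num
  have hz4 : (y : ℝ) ^ (1 / 3 : ℝ) = z ^ (4 : ℕ) := by
    rw [hz, ← Real.rpow_natCast, ← Real.rpow_mul hy0.le]; norm_num
  -- `y^{1/3} < log x`
  have hlogx : (y : ℝ) ^ (1 / 3 : ℝ) < Real.log x := by
    by_contra hcon
    push Not at hcon
    have h1 : Real.log x ^ 3 ≤ ((y : ℝ) ^ (1 / 3 : ℝ)) ^ (3 : ℕ) := pow_le_pow_left₀ hL0.le hcon 3
    have h2 : ((y : ℝ) ^ (1 / 3 : ℝ)) ^ (3 : ℕ) = y := by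
      rw [← Real.rpow_natCast, ← Real.rpow_mul hy0.le]; norm_num
    linarith
  have hz3' : (1728 : ℝ) ≤ z ^ (3 : ℕ) := by
    have := pow_le_pow_left₀ (by norm_num) hz12 3
    norm_num at this
    exact this
  calc saddleSum (3 / 4) y ≤ ∑ p ∈ Nat.primesLE y, Real.log p * (p : ℝ) ^ (-(3 / 4 : ℝ)) + 30 := h1
    _ ≤ 4 * Real.log 4 * (y : ℝ) ^ (1 / 4 : ℝ) + 30 := by linarith
    _ ≤ 6 * z ^ (3 : ℕ) + 30 := by rw [hz3] at hpow0 ⊢; nlinarith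
    _ ≤ z ^ (4 : ℕ) := by nlinarith
    _ = (y : ℝ) ^ (1 / 3 : ℝ) := hz4.symm
    _ ≤ Real.log x := hlogx.le

/-! ### The uniform lower bounds for `φ₂(α(x, y), y)` and `α(x, y)` -/

/-- **`φ₂(α(x, y), y) ≥ c log x · log y` uniformly for `x ≥ y ≥ y₀`** (`c > 0` absolute) — the lower
half of Hildebrand–Tenenbaum's `φ₂(α, y) ≍ (1 + log x/y) log x · log y` [Lemma 4 (3.8), `k = 2`;
Thm 2 (2.5)] over the WHOLE range (`(log x)^3 ≤ y`: the tree's `le_saddlePhi₂_saddlePoint`; `y < (log x)^3`: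
`α ≤ 3/4` and the two regimes `α log y ≤ 1`, `1/log y < α ≤ 3/4` of the module docstring).
[cite: HildebrandTenenbaum1986, Lemma 4 (3.8)] -/
theorem le_saddlePhi₂_saddlePoint_uniform :
    ∃ c : ℝ, ∃ y₀ : ℕ, 0 < c ∧ 2 ≤ y₀ ∧ ∀ (x : ℝ) (y : ℕ), y₀ ≤ y → (y : ℝ) ≤ x →
      c * (Real.log x * Real.log y) ≤ saddlePhi₂ (saddlePoint x y) y := by
  obtain ⟨c, x₀, hc, htree⟩ := le_saddlePhi₂_saddlePoint
  obtain ⟨y₁, hy₁2, hB2⟩ := exists_log_mul_rpow_le_saddlePhi₂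
  obtain ⟨y₂, hy₂2, hB⟩ := exists_saddleSum_le_mul_rpow
  refine ⟨min c (1 / 240), max (max ⌈x₀⌉₊ y₁) (max y₂ (12 ^ 12)), lt_min hc (by norm_num),
    le_trans hy₁2 ((le_max_right _ _).trans (le_max_left _ _)), fun x y hy hyx => ?_⟩
  have hyx₀ : x₀ ≤ y := le_trans (Nat.le_ceil x₀)
    (by exact_mod_cast le_trans ((le_max_left _ _).trans (le_max_left _ _)) hy)
  have hy₁ : y₁ ≤ y := le_trans ((le_max_right _ _).trans (le_max_left _ _)) hy
  have hy₂ : y₂ ≤ y := le_trans ((le_max_left _ _).trans (le_max_right _ _)) hy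
  have hy₃ : 12 ^ 12 ≤ y := le_trans ((le_max_right _ _).trans (le_max_right _ _)) hy
  have hy2 : 2 ≤ y := hy₁2.trans hy₁
  have hy1 : (1 : ℝ) < y := by exact_mod_cast lt_of_lt_of_le one_lt_two hy2
  have hx1 : 1 < x := by linarith
  have hℓ : 0 < Real.log y := Real.log_pos hy1
  have hL : 0 < Real.log x := Real.log_pos hx1
  have hmin1 : min c (1 / 240) ≤ c := min_le_left _ _
  have hmin2 : min c (1 / 240) ≤ 1 / 240 := min_le_right _ _
  have hLℓ : 0 ≤ Real.log x * Real.log y := by positivity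
  set α : ℝ := saddlePoint x y with hα
  have hα0 : 0 < α := saddlePoint_pos hx1 hy2
  have hsum : saddleSum α y = Real.log x := saddleSum_saddlePoint hx1 hy2
  by_cases hcase : Real.log x ^ 3 ≤ y
  · calc min c (1 / 240) * (Real.log x * Real.log y) ≤ c * (Real.log x * Real.log y) :=
          mul_le_mul_of_nonneg_right hmin1 hLℓ
      _ ≤ saddlePhi₂ α y := htree x y (le_trans hyx₀ hyx) hcase hyx
  push Not at hcase
  have hα34 : α ≤ 3 / 4 := saddlePoint_le_three_quarters hy₃ hcase hx1
  by_cases hA : α * Real.log y ≤ 1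
  · -- regime `α log y ≤ 1`
    have h1 := card_div_le_saddlePhi₂ hα0 hA
    have h2 := saddleSum_le_card_div hα0 hA
    rw [hsum] at h2
    have hℓα : Real.log y ≤ 1 / α := by rw [le_div_iff₀ hα0]; linarith
    calc min c (1 / 240) * (Real.log x * Real.log y) ≤ 1 / 240 * (Real.log x * Real.log y) :=
          mul_le_mul_of_nonneg_right hmin2 hLℓ
      _ ≤ Real.log x / 9 * Real.log y := by nlinarith
      _ ≤ Real.log x / 9 * (1 / α) := mul_le_mul_of_nonneg_left hℓα (by positivity)
      _ = Real.log x * (1 / (9 * α)) := by ring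
      _ ≤ (#(Nat.primesLE y) / α) * (1 / (9 * α)) := mul_le_mul_of_nonneg_right h2 (by positivity)
      _ = #(Nat.primesLE y) / (9 * α ^ 2) := by field_simp
      _ ≤ saddlePhi₂ α y := h1
  · -- regime `1/log y < α ≤ 3/4`
    push Not at hA
    have hαℓ : 1 / Real.log y < α := by rw [div_lt_iff₀ hℓ]; linarith
    have h1 := hB y α hy₂ hαℓ hα34
    rw [hsum] at h1
    have h2 := hB2 y α hy₁ hα0 (by linarith)
    have hpow0 : 0 ≤ (y : ℝ) ^ (1 - α) := Real.rpow_nonneg (by linarith) _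
    calc min c (1 / 240) * (Real.log x * Real.log y) ≤ 1 / 240 * (Real.log x * Real.log y) :=
          mul_le_mul_of_nonneg_right hmin2 hLℓ
      _ = 1 / 240 * Real.log x * Real.log y := by ring
      _ ≤ 1 / 240 * (30 * (y : ℝ) ^ (1 - α)) * Real.log y := by gcongr
      _ = Real.log y / 8 * (y : ℝ) ^ (1 - α) := by ring
      _ ≤ saddlePhi₂ α y := h2

/-- **`φ₂(α(x,y), y) ≥ (log x)² log y/(6y)`** for `x ≥ y ≥ 2` (Cauchy–Schwarz `(-φ₁)² ≤ φ₂ · π(y)`,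
`-φ₁(α, y) = log x`, `π(y) ≤ 6y/log y`) — the lower half of [Lemma 4 (3.8), `k = 2`] in the range
`y ≤ log x`, up to the constant. [cite: HildebrandTenenbaum1986, Lemma 4 (3.8)] -/
theorem sq_log_div_le_saddlePhi₂_saddlePoint {x : ℝ} (hy : 2 ≤ y) (hyx : (y : ℝ) ≤ x) :
    Real.log x ^ 2 * Real.log y / (6 * y) ≤ saddlePhi₂ (saddlePoint x y) y := by
  have hy1 : (1 : ℝ) < y := by exact_mod_cast lt_of_lt_of_le one_lt_two hy
  have hy0 : (0 : ℝ) < y := by linarith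
  have hx1 : 1 < x := by linarith
  have hℓ : 0 < Real.log y := Real.log_pos hy1
  have hα0 : 0 < saddlePoint x y := saddlePoint_pos hx1 hy
  have hsum : saddleSum (saddlePoint x y) y = Real.log x := saddleSum_saddlePoint hx1 hy
  have h1 := saddleSum_sq_le_saddlePhi₂_mul_card (y := y) hα0
  rw [hsum] at h1
  have h2 := card_primesLE_le_six_mul_div_log hy
  have hφ0 : 0 ≤ saddlePhi₂ (saddlePoint x y) y := saddlePhi₂_nonneg _ _
  rw [div_le_iff₀ (by positivity)]
  calc Real.log x ^ 2 * Real.log y ≤ saddlePhi₂ (saddlePoint x y) y * #(Nat.primesLE y) * Real.log y :=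
        mul_le_mul_of_nonneg_right h1 hℓ.le
    _ ≤ saddlePhi₂ (saddlePoint x y) y * (6 * ((y : ℝ) / Real.log y)) * Real.log y := by gcongr
    _ = saddlePhi₂ (saddlePoint x y) y * (6 * y) := by field_simp

/-- **`α(x, y) ≥ (1/12) min(1/log y, y/(log y · log x))`** beyond a threshold in `y`, for `x ≥ y` —
Hildebrand–Tenenbaum's `α ≫ ū/(u log y)` [Lemma 2 (3.3)–(3.4)]: if `α log y ≤ 1` then
`log x = -φ₁(α, y) ≥ π(y)/(3α) ≥ y/(12 α log y)`. [cite: HildebrandTenenbaum1986, Lemma 2 (3.3)–(3.4)] -/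
theorem exists_min_le_saddlePoint :
    ∃ y₀ : ℕ, 2 ≤ y₀ ∧ ∀ (x : ℝ) (y : ℕ), y₀ ≤ y → (y : ℝ) ≤ x →
      1 / 12 * min (1 / Real.log y) (y / (Real.log y * Real.log x)) ≤ saddlePoint x y := by
  obtain ⟨y₀, hy₀2, hπ⟩ := exists_card_primesLE_ge
  refine ⟨y₀, hy₀2, fun x y hy hyx => ?_⟩
  have hy2 : 2 ≤ y := hy₀2.trans hy
  have hy1 : (1 : ℝ) < y := by exact_mod_cast lt_of_lt_of_le one_lt_two hy2
  have hy0 : (0 : ℝ) < y := by linarith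
  have hx1 : 1 < x := by linarith
  have hℓ : 0 < Real.log y := Real.log_pos hy1
  have hL : 0 < Real.log x := Real.log_pos hx1
  set α : ℝ := saddlePoint x y with hα
  have hα0 : 0 < α := saddlePoint_pos hx1 hy2
  have hsum : saddleSum α y = Real.log x := saddleSum_saddlePoint hx1 hy2
  have hmin0 : 0 ≤ min (1 / Real.log y) (y / (Real.log y * Real.log x)) :=
    le_min (by positivity) (by positivity)
  by_cases hA : α * Real.log y ≤ 1
  · have h1 := card_div_le_saddleSum hα0 hA
    rw [hsum] at h1
    have h2 := hπ y hy
    -- `y/(4 log y) ≤ π(y) ≤ 3 α log x`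
    have h3 : (#(Nat.primesLE y) : ℝ) ≤ 3 * α * Real.log x := by
      rw [div_le_iff₀ (by positivity)] at h1; linarith
    calc 1 / 12 * min (1 / Real.log y) (y / (Real.log y * Real.log x))
        ≤ 1 / 12 * (y / (Real.log y * Real.log x)) :=
          mul_le_mul_of_nonneg_left (min_le_right _ _) (by norm_num)
      _ = (y / (4 * Real.log y)) / (3 * Real.log x) := by field_simp; ring
      _ ≤ (3 * α * Real.log x) / (3 * Real.log x) :=
          div_le_div_of_nonneg_right (h2.trans h3) (by positivity)
      _ = α := by field_simp
  · push Not at hA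
    calc 1 / 12 * min (1 / Real.log y) (y / (Real.log y * Real.log x)) ≤ 1 * (1 / Real.log y) :=
          mul_le_mul (by norm_num) (min_le_left _ _) hmin0 zero_le_one
      _ = 1 / Real.log y := one_mul _
      _ ≤ α := by rw [div_le_iff₀ hℓ]; linarith

/-- **`(1 - α(x, y)) log y ≤ 2 log(80 u₀)` when `log x ≤ u₀ log y`** (`u₀ ≥ 1`, `y` beyond a threshold,
`x ≥ y`): "`α(x, y) = 1 + O(1/log y)` (`y ≤ x ≤ y^{u₀}`), which follows easily from the equation
defining `α`" [HildebrandTenenbaum1986, §6, p. 283]: `u₀ log y ≥ -φ₁(α, y) ≥ Σ_{√y < p ≤ y} log p · p^{-α}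
≥ y^{(1-α)/2} Σ_{√y < p ≤ y} log p/p ≥ y^{(1-α)/2} log y/80`. [cite: HildebrandTenenbaum1986, §6 (proof of Thm 3)] -/
theorem exists_one_sub_saddlePoint_mul_log_le {u₀ : ℝ} (hu₀ : 1 ≤ u₀) :
    ∃ y₀ : ℕ, 2 ≤ y₀ ∧ ∀ (x : ℝ) (y : ℕ), y₀ ≤ y → (y : ℝ) ≤ x → Real.log x ≤ u₀ * Real.log y →
      (1 - saddlePoint x y) * Real.log y ≤ 2 * Real.log (80 * u₀) := by
  obtain ⟨t₀, ht₀2, -, -, hlog⟩ := exists_blocks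
  refine ⟨max ⌈Real.exp 8⌉₊ ⌈t₀ ^ 2⌉₊, ?_, fun x y hy hyx hux => ?_⟩
  · have h8 : (2 : ℝ) ≤ Real.exp 8 := by linarith [Real.add_one_le_exp (8 : ℝ)]
    have : (2 : ℝ) ≤ ⌈Real.exp 8⌉₊ := le_trans h8 (Nat.le_ceil _)
    exact le_trans (by exact_mod_cast this) (le_max_left _ _)
  have hye : Real.exp 8 ≤ y := le_trans (Nat.le_ceil _) (by exact_mod_cast le_trans (le_max_left _ _) hy)
  have hyt : t₀ ^ 2 ≤ y := le_trans (Nat.le_ceil _) (by exact_mod_cast le_trans (le_max_right _ _) hy)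
  have hy2r : (2 : ℝ) ≤ y := le_trans (by linarith [Real.add_one_le_exp (8 : ℝ)]) hye
  have hy2 : 2 ≤ y := by exact_mod_cast hy2r
  have hy1 : (1 : ℝ) < y := by linarith
  have hy0 : (0 : ℝ) < y := by linarith
  have hx1 : 1 < x := by linarith
  have hℓ8 : 8 ≤ Real.log y := by
    have := Real.log_le_log (Real.exp_pos 8) hye
    rwa [Real.log_exp] at this
  have hℓ : 0 < Real.log y := by linarith
  have hlog80 : 0 ≤ Real.log (80 * u₀) := Real.log_nonneg (by linarith)
  set α : ℝ := saddlePoint x y with hα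
  have hα0 : 0 < α := saddlePoint_pos hx1 hy2
  have hsum : saddleSum α y = Real.log x := saddleSum_saddlePoint hx1 hy2
  by_cases hα1 : 1 ≤ α
  · calc (1 - α) * Real.log y ≤ 0 := mul_nonpos_of_nonpos_of_nonneg (by linarith) hℓ.le
      _ ≤ 2 * Real.log (80 * u₀) := by positivity
  push Not at hα1
  -- `√y ≥ t₀` and the block bound on `(√y, y]`
  have hsqrt : t₀ ≤ (y : ℝ) ^ (1 - 1 / 2 : ℝ) := by
    rw [show (1 - 1 / 2 : ℝ) = 1 / 2 by norm_num]
    have h1 : t₀ = (t₀ ^ (2 : ℕ)) ^ (1 / 2 : ℝ) := by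
      rw [← Real.rpow_natCast, ← Real.rpow_mul (by linarith)]; norm_num
    rw [h1]
    exact Real.rpow_le_rpow (by positivity) (by exact_mod_cast hyt) (by norm_num)
  have hS := hlog (1 / 2) y hy1 (by norm_num) (by norm_num) (by linarith) hsqrt
  rw [Nat.floor_natCast] at hS
  -- `-φ₁(α, y) ≥ Σ_{√y < p ≤ y} log p · p^{-α} ≥ y^{(1-α)/2} Σ_{√y < p ≤ y} log p/p`
  set w : ℝ := (y : ℝ) ^ ((1 - α) / 2) with hw
  have hw0 : 0 < w := Real.rpow_pos_of_pos hy0 _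
  have h1 := sum_primesLE_log_mul_rpow_le_saddleSum hα0 y
  rw [hsum] at h1
  have h2 : w * ∑ p ∈ (Nat.primesLE y).filter (fun p : ℕ => (y : ℝ) ^ (1 - 1 / 2 : ℝ) < (p : ℝ)),
      Real.log p / p ≤ ∑ p ∈ Nat.primesLE y, Real.log p * (p : ℝ) ^ (-α) := by
    rw [Finset.mul_sum]
    calc ∑ p ∈ (Nat.primesLE y).filter (fun p : ℕ => (y : ℝ) ^ (1 - 1 / 2 : ℝ) < (p : ℝ)),
          w * (Real.log p / p)
        ≤ ∑ p ∈ (Nat.primesLE y).filter (fun p : ℕ => (y : ℝ) ^ (1 - 1 / 2 : ℝ) < (p : ℝ)),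
          Real.log p * (p : ℝ) ^ (-α) := by
          refine Finset.sum_le_sum fun p hp => ?_
          rw [Finset.mem_filter] at hp
          obtain ⟨hp, hps⟩ := hp
          have hp2 : (2 : ℝ) ≤ p := by exact_mod_cast (Nat.prime_of_mem_primesLE hp).two_le
          have hp0 : (0 : ℝ) < p := by linarith
          have hlogp : 0 ≤ Real.log p := Real.log_nonneg (by linarith)
          rw [show (1 - 1 / 2 : ℝ) = 1 / 2 by norm_num] at hps
          -- `w = (y^{1/2})^{1-α} ≤ p^{1-α}` and `p^{-α} = p^{1-α}/p`
          have hwp : w ≤ (p : ℝ) ^ (1 - α) := by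
            rw [hw, show (1 - α) / 2 = 1 / 2 * (1 - α) by ring, Real.rpow_mul hy0.le]
            exact Real.rpow_le_rpow (Real.rpow_nonneg hy0.le _) hps.le (by linarith)
          have hpα : (p : ℝ) ^ (-α) = (p : ℝ) ^ (1 - α) / p := by
            rw [sub_eq_add_neg, Real.rpow_add hp0, Real.rpow_one]; field_simp
          rw [hpα]
          calc w * (Real.log p / p) = Real.log p * (w / p) := by ring
            _ ≤ Real.log p * ((p : ℝ) ^ (1 - α) / p) :=
                mul_le_mul_of_nonneg_left (div_le_div_of_nonneg_right hwp hp0.le) hlogp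
      _ ≤ ∑ p ∈ Nat.primesLE y, Real.log p * (p : ℝ) ^ (-α) := by
          refine Finset.sum_le_sum_of_subset_of_nonneg (Finset.filter_subset _ _) fun p hp _ => ?_
          have hp2 : (2 : ℝ) ≤ p := by exact_mod_cast (Nat.prime_of_mem_primesLE hp).two_le
          have : 0 ≤ (p : ℝ) ^ (-α) := Real.rpow_nonneg (by linarith) _
          have : 0 ≤ Real.log p := Real.log_nonneg (by linarith)
          positivity
  -- so `w · log y/80 ≤ log x ≤ u₀ log y`, `w ≤ 80 u₀`
  have h3 : w * (Real.log y / 80) ≤ u₀ * Real.log y := by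
    calc w * (Real.log y / 80) = w * (1 / 2 * Real.log y / 40) := by ring
      _ ≤ w * ∑ p ∈ (Nat.primesLE y).filter (fun p : ℕ => (y : ℝ) ^ (1 - 1 / 2 : ℝ) < (p : ℝ)),
          Real.log p / p := mul_le_mul_of_nonneg_left hS hw0.le
      _ ≤ Real.log x := h2.trans h1
      _ ≤ u₀ * Real.log y := hux
  have h4 : w ≤ 80 * u₀ := by nlinarith
  have h5 : Real.log w ≤ Real.log (80 * u₀) := Real.log_le_log hw0 h4
  rw [hw, Real.log_rpow hy0] at h5
  linarith

/-! ### Two-point comparison of `φ₂` without a lower bound on `σ` -/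

/-- `e^t - 1 ≤ t e^t` (`1 - e^{-t} ≤ t`). [folklore] -/
private theorem exp_sub_one_le_mul_exp' (t : ℝ) : Real.exp t - 1 ≤ t * Real.exp t := by
  have h1 : 1 - Real.exp (-t) ≤ t := by have := Real.add_one_le_exp (-t); linarith
  have h3 : Real.exp t - 1 = Real.exp t * (1 - Real.exp (-t)) := by
    rw [mul_sub, mul_one, ← Real.exp_add, add_neg_cancel, Real.exp_zero]
  rw [h3, mul_comm]
  exact mul_le_mul_of_nonneg_right h1 (Real.exp_pos t).le

/-- Termwise two-point comparison: for `p ≥ 2` and `0 < σ' ≤ σ`,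
`p^{σ'}/(p^{σ'} - 1)² ≤ exp((σ - σ')(log p + 2/σ')) · p^σ/(p^σ - 1)²`. With `a = p^{σ'}`,
`b = p^σ = a e^{δλ}` (`δ = σ - σ'`, `λ = log p`): `b - 1 = (a-1)e^{δλ} + (e^{δλ} - 1) ≤ e^{δλ}(a - 1 + δλ)
≤ e^{δλ}(a-1)(1 + δ/σ') ≤ (a-1) e^{δλ + δ/σ'}` as `σ'λ ≤ a - 1`. [folklore] -/
theorem rpow_div_sq_le_exp_mul {p : ℕ} (hp : 2 ≤ p) {σ σ' : ℝ} (hσ' : 0 < σ') (hle : σ' ≤ σ) :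
    (p : ℝ) ^ σ' / ((p : ℝ) ^ σ' - 1) ^ 2 ≤
      Real.exp ((σ - σ') * (Real.log p + 2 / σ')) * ((p : ℝ) ^ σ / ((p : ℝ) ^ σ - 1) ^ 2) := by
  have hp2 : (2 : ℝ) ≤ p := by exact_mod_cast hp
  have hp0 : (0 : ℝ) < p := by linarith
  have hlam : 0 < Real.log p := Real.log_pos (by linarith)
  set lam : ℝ := Real.log p with hlamdef
  set δ : ℝ := σ - σ' with hδdef
  have hδ : 0 ≤ δ := by rw [hδdef]; linarith
  set a : ℝ := (p : ℝ) ^ σ' with hadef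
  set b : ℝ := (p : ℝ) ^ σ with hbdef
  have ha : a = Real.exp (σ' * lam) := by rw [hadef, Real.rpow_def_of_pos hp0, mul_comm]
  have hb : b = a * Real.exp (δ * lam) := by
    rw [hbdef, Real.rpow_def_of_pos hp0, ha, ← Real.exp_add]
    congr 1
    rw [hlamdef, hδdef]; ring
  have ha1 : σ' * lam ≤ a - 1 := by
    rw [ha]; have := Real.add_one_le_exp (σ' * lam); linarith
  have ha1pos : 0 < a - 1 := lt_of_lt_of_le (mul_pos hσ' hlam) ha1
  have ha0 : 0 < a := by linarith
  have he0 : 0 < Real.exp (δ * lam) := Real.exp_pos _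
  have he1 : 1 ≤ Real.exp (δ * lam) := Real.one_le_exp (by positivity)
  set F : ℝ := Real.exp (δ * lam + δ / σ') with hF
  have hb1 : b - 1 ≤ (a - 1) * F := by
    have h1 : b - 1 = (a - 1) * Real.exp (δ * lam) + (Real.exp (δ * lam) - 1) := by rw [hb]; ring
    have hE1 := exp_sub_one_le_mul_exp' (δ * lam)
    have h2 : δ * lam ≤ (a - 1) * (δ / σ') := by
      rw [mul_div_assoc', le_div_iff₀ hσ']
      nlinarith
    have h3 : 1 + δ / σ' ≤ Real.exp (δ / σ') := by linarith [Real.add_one_le_exp (δ / σ')]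
    calc b - 1 = (a - 1) * Real.exp (δ * lam) + (Real.exp (δ * lam) - 1) := h1
      _ ≤ (a - 1) * Real.exp (δ * lam) + δ * lam * Real.exp (δ * lam) := by linarith
      _ = Real.exp (δ * lam) * (a - 1 + δ * lam) := by ring
      _ ≤ Real.exp (δ * lam) * ((a - 1) * (1 + δ / σ')) :=
          mul_le_mul_of_nonneg_left (by nlinarith) he0.le
      _ ≤ Real.exp (δ * lam) * ((a - 1) * Real.exp (δ / σ')) :=
          mul_le_mul_of_nonneg_left (mul_le_mul_of_nonneg_left h3 ha1pos.le) he0.le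
      _ = (a - 1) * F := by rw [hF, Real.exp_add]; ring
  have hb1pos : 0 < b - 1 := by
    have : a ≤ b := by rw [hb]; exact le_mul_of_one_le_right ha0.le he1
    linarith
  have hF2 : F ^ 2 = Real.exp (δ * (lam + 2 / σ')) * Real.exp (δ * lam) := by
    rw [hF, sq, ← Real.exp_add, ← Real.exp_add]; congr 1; ring
  rw [show Real.exp (δ * (lam + 2 / σ')) * (b / (b - 1) ^ 2) =
      Real.exp (δ * (lam + 2 / σ')) * b / (b - 1) ^ 2 by ring,
    div_le_div_iff₀ (pow_pos ha1pos 2) (pow_pos hb1pos 2)]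
  calc a * (b - 1) ^ 2 ≤ a * ((a - 1) * F) ^ 2 :=
        mul_le_mul_of_nonneg_left (pow_le_pow_left₀ hb1pos.le hb1 2) ha0.le
    _ = a * F ^ 2 * (a - 1) ^ 2 := by ring
    _ = Real.exp (δ * (lam + 2 / σ')) * b * (a - 1) ^ 2 := by rw [hF2, hb]; ring

/-- **Two-point comparison of `φ₂`**: `φ₂(σ', y) ≤ exp((σ - σ')(log y + 2/σ')) φ₂(σ, y)` for
`0 < σ' ≤ σ` (termwise `rpow_div_sq_le_exp_mul` and `log p ≤ log y`); unlike `saddlePhi₂_le_rpow_mul`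
no lower bound on `σ'` is needed (at the price of the factor `e^{2(σ-σ')/σ'}`). [folklore] -/
theorem saddlePhi₂_le_exp_mul_saddlePhi₂ {σ σ' : ℝ} (hσ' : 0 < σ') (hle : σ' ≤ σ) :
    saddlePhi₂ σ' y ≤ Real.exp ((σ - σ') * (Real.log y + 2 / σ')) * saddlePhi₂ σ y := by
  rw [saddlePhi₂_def, saddlePhi₂_def, Finset.mul_sum]
  refine Finset.sum_le_sum fun p hp => ?_
  obtain ⟨hpy, hpp⟩ := Nat.mem_primesLE.1 hp
  have hp2 : (2 : ℝ) ≤ p := by exact_mod_cast hpp.two_le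
  have hp0 : (0 : ℝ) < p := by linarith
  have h := rpow_div_sq_le_exp_mul hpp.two_le hσ' hle
  have hlogpy : Real.log p ≤ Real.log y := Real.log_le_log hp0 (by exact_mod_cast hpy)
  have hmono : Real.exp ((σ - σ') * (Real.log p + 2 / σ')) ≤
      Real.exp ((σ - σ') * (Real.log y + 2 / σ')) := by
    rw [Real.exp_le_exp]
    exact mul_le_mul_of_nonneg_left (by linarith) (by linarith)
  have hb0 : 0 ≤ (p : ℝ) ^ σ / ((p : ℝ) ^ σ - 1) ^ 2 := by positivity
  calc Real.log p ^ 2 * ((p : ℝ) ^ σ' / ((p : ℝ) ^ σ' - 1) ^ 2)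
      ≤ Real.log p ^ 2 * (Real.exp ((σ - σ') * (Real.log p + 2 / σ')) *
          ((p : ℝ) ^ σ / ((p : ℝ) ^ σ - 1) ^ 2)) := mul_le_mul_of_nonneg_left h (sq_nonneg _)
    _ ≤ Real.log p ^ 2 * (Real.exp ((σ - σ') * (Real.log y + 2 / σ')) *
          ((p : ℝ) ^ σ / ((p : ℝ) ^ σ - 1) ^ 2)) :=
        mul_le_mul_of_nonneg_left (mul_le_mul_of_nonneg_right hmono hb0) (sq_nonneg _)
    _ = Real.exp ((σ - σ') * (Real.log y + 2 / σ')) *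
          (Real.log p ^ 2 * ((p : ℝ) ^ σ / ((p : ℝ) ^ σ - 1) ^ 2)) := by ring

/-! ### The second-order upper bound at a saddle point -/

/-- **Second-order upper bound at a saddle point.** For `0 < a ≤ b` and `L'` with `-φ₁(a, y) = L'`
(i.e. `a` is the saddle point of `e^{L'}`):
`(b L' + log ζ(b, y)) - (a L' + log ζ(a, y)) ≤ φ₂(a, y)(b - a)²/2`. The function
`H(σ) = σ L' + log ζ(σ, y) - φ₂(a, y)(σ - a)²/2` has `H'(σ) = L' + φ₁(σ, y) - φ₂(a, y)(σ - a) ≤ 0`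
for `σ > 0` (tangent inequality `saddleSum_sub_mul_le` at `a`), so `H(b) ≤ H(a)`. Companion of the
gain `log_smoothZeta_sub_ge`. [cite: HildebrandTenenbaum1986, §6 (proof of Thm 3, (6.3)–(6.5))] -/
theorem log_smoothZeta_sub_le {a b L' : ℝ} (ha : 0 < a) (hab : a ≤ b) (hL : saddleSum a y = L') :
    (b * L' + Real.log (smoothZeta b y)) - (a * L' + Real.log (smoothZeta a y)) ≤
      saddlePhi₂ a y * (b - a) ^ 2 / 2 := by
  have hderiv : ∀ σ : ℝ, 0 < σ →
      HasDerivAt (fun s : ℝ => s * L' + Real.log (smoothZeta s y) - saddlePhi₂ a y * (s - a) ^ 2 / 2)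
        (L' - saddleSum σ y - saddlePhi₂ a y * (σ - a)) σ := by
    intro σ hσ
    have h1 : HasDerivAt (fun s : ℝ => s * L') L' σ := by
      simpa using (hasDerivAt_id σ).mul_const L'
    have h2 := hasDerivAt_log_smoothZeta (y := y) hσ
    have h3' : HasDerivAt (fun s : ℝ => saddlePhi₂ a y * ((s - a) * (s - a)) / 2)
        (saddlePhi₂ a y * (1 * (σ - a) + (σ - a) * 1) / 2) σ :=
      ((((hasDerivAt_id σ).sub_const a).mul ((hasDerivAt_id σ).sub_const a)).const_mul _).div_const 2
    have hfun : (fun s : ℝ => saddlePhi₂ a y * (s - a) ^ 2 / 2) =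
        fun s => saddlePhi₂ a y * ((s - a) * (s - a)) / 2 := by
      funext s; ring
    have h3 : HasDerivAt (fun s : ℝ => saddlePhi₂ a y * (s - a) ^ 2 / 2) (saddlePhi₂ a y * (σ - a)) σ := by
      rw [hfun]
      refine h3'.congr_deriv ?_
      ring
    refine ((h1.add h2).sub h3).congr_deriv ?_
    ring
  set H : ℝ → ℝ := fun s : ℝ => s * L' + Real.log (smoothZeta s y) - saddlePhi₂ a y * (s - a) ^ 2 / 2
    with hH
  have hH'le : ∀ σ : ℝ, 0 < σ → L' - saddleSum σ y - saddlePhi₂ a y * (σ - a) ≤ 0 := by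
    intro σ hσ
    have ht := saddleSum_sub_mul_le (y := y) ha hσ
    rw [hL] at ht
    linarith
  have hanti : AntitoneOn H (Set.Icc a b) := by
    refine antitoneOn_of_deriv_nonpos (convex_Icc a b) ?_ ?_ ?_
    · exact fun σ hσ => (hderiv σ (lt_of_lt_of_le ha hσ.1)).continuousAt.continuousWithinAt
    · intro σ hσ
      rw [interior_Icc] at hσ
      exact (hderiv σ (ha.trans hσ.1)).differentiableAt.differentiableWithinAt
    · intro σ hσ
      rw [interior_Icc] at hσ
      rw [(hderiv σ (ha.trans hσ.1)).deriv]
      exact hH'le σ (ha.trans hσ.1)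
  have hHab : H b ≤ H a := hanti ⟨le_rfl, hab⟩ ⟨hab, le_rfl⟩ hab
  simp only [hH] at hHab
  have h0 : (a - a) ^ 2 = 0 := by ring
  rw [h0, mul_zero, zero_div, sub_zero] at hHab
  linarith

end Literature.NumberTheory.Sieve
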